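import Summits.Ventures.HodgeRepro2.T5SU11JacobiJointLawAsymptotic

/-!
# The exact joint law of the three coordinates at `λ = 0`

At `λ = 0` the phase `log|a(g)|` is exactly `Exp(k − 2)` under `m_k dν/m̂_k(0)` (`T5SU11PhaseTail.phase_tail_prob`),
and `|g·0|²`, `t(g)` are increasing functions of it, so the joint tail event of the three coordinates —
the single phase-threshold event `{max(x, −½ log(1 − y), log cosh τ) < log|a|}` (`setOf_joint_gt_eq'`) — has
the exact probability

  **`P_{k,0}(log|a| > x, |g·0|² > y, t > τ) = e^{−(k−2) max(x, −½ log(1−y), log cosh τ)}`**   (`joint_tail_prob_zero'`)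

for `k > 2`, `x ≥ 0`, `y < 1`, `τ ≥ 0`; in the rescaled coordinates of `T5SU11JacobiJointLawAsymptotic`,

  **`P_{k,0}(k log|a| > x, k|g·0|²/2 > y, k t²/2 > z) = e^{−(k−2)·jointThreshold(x, y, z, k)}`**   (`joint_tail_prob_zero`),

whose limit `e^{−max(x, y, z)}` is the `λ = 0` case of `tendsto_joint_tail_prob_atTop`. The joint law at
`λ = 0` is the comonotone coupling of its three marginals `Exp(k − 2)`, `Beta(1, (k−2)/2)`
(`T5SU11OrbitRadiusLaw`) and `cosh(τ)^{−(k−2)}` (`T5SU11PhaseTailCartan`). Nothing is claimed about (N).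

Blind lane: Mathlib + the HodgeRepro2 prefix only; no sorry; axioms ⊆ {propext, Classical.choice,
Quot.sound}.
-/

namespace Summit.Ventures.HodgeRepro2.T5SU11JacobiJointLawExact

open MeasureTheory MeasureTheory.Measure Metric Set Filter Topology
open T5SU11Unimodular T5SU11Fibration T5SU11Cartan T5SU11CartanProjection T5HaarCircle
  T5BergmanCoefficient T5SU11FibrationHaar T5SU11JacobiWeight T5SU11PhaseLaw T5SU11PhaseLawLintegral
  T5SU11PhaseTail T5SU11PhaseTailCartan T5SU11OrbitRadiusLaw T5SU11JacobiJointLawAsymptotic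
open scoped Real ENNReal

/-- **The joint event with general thresholds is one phase-threshold event**: for `y < 1`, `τ ≥ 0`,
`{x < log|a|} ∩ {y < |g·0|²} ∩ {τ < t} = {max(x, −½ log(1 − y), log cosh τ) < log|a|}`. -/
theorem setOf_joint_gt_eq' {x y τ : ℝ} (hy : y < 1) (hτ : 0 ≤ τ) :
    {g : SU11 | x < Real.log ‖mat g 0 0‖ ∧ y < ‖orbit g‖ ^ 2 ∧ τ < cartanT g}
      = {g : SU11 | max x (max (-(1 / 2) * Real.log (1 - y)) (Real.log (Real.cosh τ)))
          < Real.log ‖mat g 0 0‖} := by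
  ext g
  have h1 := Set.ext_iff.mp (setOf_norm_orbit_sq_gt_eq hy) g
  have h2 := Set.ext_iff.mp (setOf_cartanT_gt_eq hτ) g
  simp only [mem_setOf_eq] at h1 h2 ⊢
  rw [h1, h2, max_lt_iff, max_lt_iff]

section measure

variable [MeasurableSpace Circle] [BorelSpace Circle]

/-- **THE EXACT JOINT LAW AT `λ = 0`, general thresholds**: for `k > 2`, `x ≥ 0`, `y < 1`, `τ ≥ 0`,
`P_{k,0}(log|a| > x, |g·0|² > y, t > τ) = e^{−(k−2) max(x, −½ log(1−y), log cosh τ)}`. -/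
theorem joint_tail_prob_zero' {k x y τ : ℝ} (hk : 2 < k) (hx : 0 ≤ x) (hy : y < 1) (hτ : 0 ≤ τ) :
    (∫⁻ g, {g : SU11 | x < Real.log ‖mat g 0 0‖ ∧ y < ‖orbit g‖ ^ 2 ∧ τ < cartanT g}.indicator
        (fun g => ENNReal.ofReal ((1 - ‖orbit g‖ ^ 2) ^ (k / 2))) g ∂(nu haarCircle))
      / ENNReal.ofReal (2 * π / (k - 2))
      = ENNReal.ofReal (Real.exp (-((k - 2) *
          max x (max (-(1 / 2) * Real.log (1 - y)) (Real.log (Real.cosh τ)))))) := by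
  rw [setOf_joint_gt_eq' hy hτ]
  exact phase_tail_prob hk (le_max_of_le_left hx)

/-- **THE EXACT JOINT LAW AT `λ = 0`, rescaled thresholds**: for `k > 2`, `k > 2y`, `x ≥ 0`, `y > 0`,
`P_{k,0}(k log|a| > x, k|g·0|²/2 > y, k t²/2 > z) = e^{−(k−2)·jointThreshold(x, y, z, k)}` (for every real `z`:
`√(2z/k) = 0` when `z ≤ 0`). -/
theorem joint_tail_prob_zero {k x y : ℝ} (z : ℝ) (hk : 2 < k) (hx : 0 ≤ x) (hy : 0 < y) (hky : 2 * y < k) :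
    (∫⁻ g, {g : SU11 | x / k < Real.log ‖mat g 0 0‖ ∧ 2 * y / k < ‖orbit g‖ ^ 2 ∧
          Real.sqrt (2 * z / k) < cartanT g}.indicator
        (fun g => ENNReal.ofReal ((1 - ‖orbit g‖ ^ 2) ^ (k / 2))) g ∂(nu haarCircle))
      / ENNReal.ofReal (2 * π / (k - 2))
      = ENNReal.ofReal (Real.exp (-((k - 2) * jointThreshold x y z k))) := by
  rw [setOf_joint_gt_eq hy hky]
  exact phase_tail_prob hk (jointThreshold_nonneg hx (by linarith))

end measure

end Summit.Ventures.HodgeRepro2.T5SU11JacobiJointLawExact
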